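import Summits.Langlands.Langlands.Theorems.RankMinimalPeeling
import Literature.NumberTheory.Automorphic.TunnellOctahedralGlobal
import Literature.NumberTheory.Automorphic.GaloisActionPlaces
import Literature.NumberTheory.Automorphic.AutomorphicRepsGLSatakeFlathProofs
import Literature.NumberTheory.GaloisRepresentations.FrobeniusStableExtension
import Literature.NumberTheory.GaloisRepresentations.InducedAEUnramified
import Literature.NumberTheory.GaloisRepresentations.FrobeniusPlaces
import Literature.NumberTheory.PAdicHodge.DeRhamRestrictFieldDescentHolds
import Literature.RepresentationTheory.Semisimple.IrreducibleOfCharpoly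
import Summits.Langlands.Langlands.Theorems.SmithKummerSeedCyclicPrimeAscentGeometricDescent
import HarnessLib

/-!
# Converse descent: the cyclic prime layer-descent atom of the E-line is IN THE CONE of the root binders
# `B_w ∧ P ∧ Irr`, modulo ONE print-closed twist-matching statement (lens-4 · g42 · node `ConverseDescent`)

Cell `decomp-langlands`, lens 4 (minimal counterexample / extremal reduction), generation 42.
TYPED, NOT FILED (route freeze): this file elaborates against the tree as it stands and is meant to be
landed by the census as a Theorems helper twin; it introduces ONE new `Prop` (`ConverseTwistMatching`,
plus its guarded twin) and closes nothing on the ledger.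

## Target, BY NAME
* CPD  = `Summit.Langlands.Langlands.Theses.CyclicLayerPeeling.PrimeCyclicLayerDescent` (stmt-Langlands-27860,
  crux r2 of route `CyclicLayerPeeling`), hence
* CPD♮ = `Summit.Langlands.Langlands.Theorems.RankMinimalPeeling.NonSelfTwistedPrimeCyclicLayerDescent`
  (the E-line's residual descent atom since g39, via the tree's `nonSelfTwisted_of_primeCyclic`), hence
* E    = `Summit.Langlands.Langlands.Theses.RootDecomp1.SemisimpleAvatar` (stmt-Langlands-23598) via the tree's
  `RankMinimalPeeling.semisimpleAvatar_of_pieces`.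

## The extremal reduction (why g41 stalled and what dissolves it)
g39–g41 attacked CPD♮ from ABOVE: given the cuspidal weak base change `P` of `π` to the cyclic prime layer
`M/K` and a semisimple avatar `r` of `P`, descend `r` to an avatar of `π`.  Every such line died at the same
point (g41 `HyperplaneSpreadDescent`, residual `SpreadSupply` ≡ CPD♮ in substance): at a place `v` of `K`
INERT in `M` only `t(Frob_v)^p` is pinned by `P`, over every field containing `M`, so the twist class
`t ↦ t ⊗ η^a` (`η` ↔ `M/K`) of a Clifford extension `t` of `r` is invisible from above — "information-
theoretically starved".  The minimal counterexample to CPD is therefore a pair `(π, t)` with `t|_{Γ_M} = r`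
and `t` NOT an avatar of any twist-untwisting of `π` readable on the Galois side.

g42 reads the twist on the AUTOMORPHIC side, BELOW, where nothing is starved: `π` itself lives over `K`.
1. (tree) `r` is irreducible (`Irr` over `M`: root binder `RootDecomp1.CuspidalAvatarIrreducible`), a.e.
   unramified, and its Frobenius polynomials are `Gal(M/K)`-stable because `P` is a weak base change
   (`frobStable_of_isWeakBaseChangeLiftAE` below — a local copy of the SmithKummerSeed helper
   `SmithKummerSeedCyclicPrimeDescent.frobStable_of_isWeakBaseChangeLiftAE`, whose module is not imported); so `r = t|_{Γ_M}` for some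
   `t : Γ_K → GL_n(ℚ̄_ℓ)` (Chebotarev + Brauer–Nesbitt + Clifford across a cyclic quotient, the tree's
   `FramedGaloisRep.exists_restrictField_eq_of_frobStable`).
2. (tree) `t` is geometric over `K`: de Rham at `w ∣ ℓ` over `M` by clause (i) of the root binder
   `P = RootDecomp1.PadicMemberCompatibility` applied to the avatar `t|_{Γ_M}` of the L-algebraic cuspidal
   `P`, then de Rham at `v ∣ ℓ` over `K` by Brinon–Conrad Prop. 6.3.8 (converse half), a THEOREM of the tree
   (`Literature.NumberTheory.PAdicHodge.DeRhamRestrictFieldDescent_holds`); unramified a.e. over `K` by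
   `eventually_isUnramifiedAt_of_restrictField` below, a local copy of the SmithKummerSeed helper
   `SmithKummerSeedCyclicPrimeAscent.eventually_isUnramifiedAt_of_restrictField`; irreducible over `K`
   because its restriction is.
3. (root binder) `B_w = RootDecomp1.WeakGeometricAutomorphy` (Fontaine–Mazur–Langlands, weak form) makes `t`
   automorphic: a cuspidal L-algebraic `π'` of `GL_n(𝔸_K)` a.e. Satake–Frobenius compatible with `t`.
4. (NEW piece, closed in print) `ConverseTwistMatching`: `π` and `π'` are CUSPIDAL on `GL_n(𝔸_K)` and,
   by Frobenius bookkeeping from `t ↔ π'` (over `K`) and `t|_{Γ_M} ↔ P ↔ π` (the weak base-change relation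
   `Sat(P_w) = Sat(π_v)^{f(w|v)}`), their Satake parameters satisfy `(t_{π,v})^{f_v} = (t_{π',v})^{f_v}` at
   almost every `v` (`f_v` = residue degree of `v` in the cyclic prime layer `M/K`).  This is VERBATIM the
   hypothesis of Arthur–Clozel 1989, Ch. 3, Thm. 3.1 ("Fibers of global base change", book p. 201 — "its
   statement has nothing to do with base change"; `l` need not even be prime there): hence `π' ≅ π ⊗ χ` for a
   character `χ` of `K^× N(𝔸_M^×) \ 𝔸_K^×`, i.e. (class field theory) `χ ↔ χ_gal : Gal(M/K) → ℂ^×`, and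
   `ρ := t ⊗ (ι⁻¹ χ_gal)⁻¹` is an irreducible — hence semisimple — avatar of `π`.  Tree twins of the print
   input: `ArthurClozel1989_fibres_of_baseChange` (L²-model named fact, `Literature/…/ArthurClozelBaseChange.lean`)
   and `ArthurClozel_fibres_quadratic` (`TunnellLemma.lean`, `p = 2`, RepData model).

So CPD — and with it CPD♮, g41's `SpreadSupply`, and the non-perfect sector of `RootDecomp1.AvatarDescent`
(stmt-Langlands-29149) — is NOT an independent open atom of the E-line: it lies in the cone of the root
binders `B_w ∧ P ∧ Irr` that `RootDecomp1.closes` already consumes, modulo the single print-closed statement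
`ConverseTwistMatching`.  What stays genuinely residual on the E-line is the perfect-hull sector
(`GaloisHullLift.PerfectHullDescent`, stmt-Langlands-28225: over a perfect hull there is no automorphic datum,
so step 2 has no de Rham input and step 4 no fibre theorem) and the root binders themselves.

Precedent for consuming `B_w`/`Irr` inside the E-subtree: `DetTower.frame_of_host (hB : WeakGeometricAutomorphy)
(hIrr : CuspidalAvatarIrreducible)`.  Relation to the BaseFieldAscent crux `AscentConjugationSolvable`
(stmt-Langlands-1094): its R-free atom `InertTwistCoherenceFor π P ι ρ₀` (`Cruxes/AscentConjugationSolvable/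
Atom.lean`) is the χ-form of step 4 WITHOUT the automorphic witness `π'`; `ConverseTwistMatching` is that atom
made decidable in print by adjoining `π'`, and steps 1–3 are what produce `π'` from the root cone.

## Contents
* §1 `ConverseTwistMatching` (CTM) and its guarded twin `ConverseTwistMatchingGuarded` (CTM♮, carrying CPD♮'s
  inserted non-self-twist guard verbatim).
* §2 no-excess edges: CPD → CTM, E → CTM, CTM → CTM♮, CPD♮ → CTM♮.
* §3 kernels: `primeCyclic_of_converse : Irr → P → B_w → CTM → CPD`,
  `nonSelfTwisted_of_converseGuarded : Irr → P → B_w → CTM♮ → CPD♮`, and the E-line corollaries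
  `semisimpleAvatar_of_converse`, `avatarDescent_of_converse` through `RankMinimalPeeling.semisimpleAvatar_of_pieces`.

## References
* [ArthurClozelAMS120] J. Arthur, L. Clozel, *Simple algebras, base change, and the advanced theory of the
  trace formula*, Ann. of Math. Stud. 120 (1989), Ch. 3, Thm. 3.1 (fibers of global base change, book p. 201),
  Thm. 4.2 (p. 203), Lemma 6.6.
* [BrinonConrad2009] O. Brinon, B. Conrad, *CMI Summer School notes on p-adic Hodge theory* (2009), Prop. 6.3.8.
* [HarrisTaylorAMS2001] M. Harris, R. Taylor, Ann. of Math. Stud. 151 (2001), proof of Thm. VII.1.9.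
* [Clifford1937] A. H. Clifford, Ann. of Math. 38 (1937), §§3–4.
-/

noncomputable section

set_option linter.dupNamespace false -- project-wide option; `Summit.Langlands.Langlands` is the mandated namespace

open scoped NumberField Classical
open Filter IsDedekindDomain Field
open Literature.NumberTheory.Automorphic Literature.NumberTheory.GaloisRepresentations
open Summit.Langlands.Langlands.Theses
open Summit.Langlands.Langlands.Theorems.SelfTwistRankSplit

namespace Summit.Langlands.Langlands.Theorems.ConverseDescent

/-! ## §1 The one new piece: automorphic twist matching below a cyclic prime layer -/

/-- **CTM — converse twist matching** [PRINT: Arthur–Clozel 1989, Ch. 3 Thm. 3.1 ("fibers of global base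
change", book p. 201) + class field theory for the finite-order character].  Let `π` be cuspidal L-algebraic on
`GL_n(𝔸_K)`, `M/K` Galois cyclic of prime degree, `P` a cuspidal L-algebraic weak base change of `π` to `M`,
`t : Γ_K → GL_n(ℚ̄_ℓ)` with irreducible restriction to `Γ_M` a.e. Satake–Frobenius compatible with `P`, and
`π'` CUSPIDAL L-algebraic on `GL_n(𝔸_K)` a.e. compatible with `t`.  Then `π` has a semisimple avatar at
`(ℓ, ι)`.  Print proof: the data force `(t_{π,v})^{f_v} = (t_{π',v})^{f_v}` for almost all `v` (`f_v` the
residue degree of `v` in `M/K`), which is verbatim the hypothesis of AC Thm. 3.1 for the cuspidal pair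
`(π, π')`; so `π' ≅ π ⊗ χ` with `χ` trivial on `K^× N(𝔸_M^×)`, and `ρ := t ⊗ (χ_gal)⁻¹` is an avatar of `π`.
Strictly weaker than CPD (`converseTwistMatching_of_primeCyclic`) and than E
(`converseTwistMatching_of_semisimpleAvatar`); the χ-form without the witness `π'` is the BaseFieldAscent atom
`InertTwistCoherenceFor` (`Cruxes/AscentConjugationSolvable/Atom.lean`), which is open.
(Source: Arthur–Clozel, AMS-120, Ch. 3 Thm. 3.1 — cited in prose: the statement uses summit vocabulary
`SatakeFrobCompatibleAt`, so it is a Theorems-side print binder, not a relocatable Literature fact; census G25.) -/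
def ConverseTwistMatching : Prop :=
  ∀ (K : Type) [Field K] [NumberField K] (n : ℕ) (hcpt : Literature.NumberTheory.Automorphic.isCompact_glFiniteIntegralLevel n K), 0 < n → ∀ (π : Literature.NumberTheory.Automorphic.CuspidalAutomorphicRepData n K hcpt), π.1.IsLAlgebraic → ∀ (M : Type) [Field M] [NumberField M] [Algebra K M], IsGalois K M → IsCyclic (M ≃ₐ[K] M) → (Module.finrank K M).Prime → ∀ (hM : Literature.NumberTheory.Automorphic.isCompact_glFiniteIntegralLevel n M) (P : Literature.NumberTheory.Automorphic.CuspidalAutomorphicRepData n M hM), P.1.IsLAlgebraic → Literature.NumberTheory.Automorphic.IsWeakBaseChangeLiftAE π.1 P.1 → ∀ (ℓ : ℕ) [Fact ℓ.Prime] (ι : PadicAlgCl ℓ ≃+* ℂ) (t : Literature.NumberTheory.GaloisRepresentations.FramedGaloisRep K (PadicAlgCl ℓ) n), (t.restrictField M).toGaloisRep.IsIrreducible → (∀ᶠ w : IsDedekindDomain.HeightOneSpectrum (NumberField.RingOfIntegers M) in cofinite, SatakeFrobCompatibleAt ι P.1 (t.restrictField M) w) → ∀ (π' : Literature.NumberTheory.Automorphic.CuspidalAutomorphicRepData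 n K hcpt), π'.1.IsLAlgebraic → (∀ᶠ v : IsDedekindDomain.HeightOneSpectrum (NumberField.RingOfIntegers K) in cofinite, SatakeFrobCompatibleAt ι π'.1 t v) → ∃ ρ : Literature.NumberTheory.GaloisRepresentations.FramedGaloisRep K (PadicAlgCl ℓ) n, ρ.toGaloisRep.IsSemisimple ∧ ∀ᶠ v : IsDedekindDomain.HeightOneSpectrum (NumberField.RingOfIntegers K) in cofinite, SatakeFrobCompatibleAt ι π.1 ρ v

/-- **CTM♮ — the guarded twin**: CTM with CPD♮'s inserted non-self-twist guard (the Satake multisets of `π` at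
the places inert in `M` are not a.e. invariant under rotation by `e^{2πi/p}`) carried as an extra hypothesis, so
that it is strictly weaker than CPD♮ by name (`converseTwistMatchingGuarded_of_nonSelfTwisted`) as well as than
CTM (`converseTwistMatchingGuarded_of_converseTwistMatching`).  Same print proof (the guard is not used: a
cuspidal weak base change already forces `π ≇ π ⊗ η`, AC Thm. 4.2 (a)). (Source: Arthur–Clozel, AMS-120, Ch. 3 Thm. 3.1 and
Thm. 4.2, cited in prose; census G25.) -/
def ConverseTwistMatchingGuarded : Prop :=
  ∀ (K : Type) [Field K] [NumberField K] (n : ℕ) (hcpt : Literature.NumberTheory.Automorphic.isCompact_glFiniteIntegralLevel n K), 0 < n → ∀ (π : Literature.NumberTheory.Automorphic.CuspidalAutomorphicRepData n K hcpt), π.1.IsLAlgebraic → ∀ (M : Type) [Field M] [NumberField M] [Algebra K M], IsGalois K M → IsCyclic (M ≃ₐ[K] M) → (Module.finrank K M).Prime → ¬ (∀ᶠ v : IsDedekindDomain.HeightOneSpectrum (NumberField.RingOfIntegers K) in cofinite, (∀ w : IsDedekindDomain.HeightOneSpectrum (NumberField.RingOfIntegers M), w.asIdeal.under (NumberField.RingOfIntegers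 K) = v.asIdeal → w.asIdeal.inertiaDeg (NumberField.RingOfIntegers K) ≠ 1) → ∀ α : Multiset ℂ, π.1.HasSatakeParamAt v α → α.map (fun z => Complex.exp (2 * Real.pi * Complex.I / (Module.finrank K M : ℂ)) * z) = α) → ∀ (hM : Literature.NumberTheory.Automorphic.isCompact_glFiniteIntegralLevel n M) (P : Literature.NumberTheory.Automorphic.CuspidalAutomorphicRepData n M hM), P.1.IsLAlgebraic → Literature.NumberTheory.Automorphic.IsWeakBaseChangeLiftAE π.1 P.1 → ∀ (ℓ : ℕ) [Fact ℓ.Prime] (ι : PadicAlgCl ℓ ≃+* ℂ) (t : Literature.NumberTheory.GaloisRepresentations.FramedGaloisRep K (PadicAlgCl ℓ) n), (t.restrictField M).toGaloisRep.IsIrreducible → (∀ᶠ w : IsDedekindDomain.HeightOneSpectrum (NumberField.RingOfIntegers M) in cofinite, SatakeFrobCompatibleAt ι P.1 (t.restrictField M) w) → ∀ (π' : Literature.NumberTheory.Automorphic.CuspidalAutomorphicRepData n K hcpt), π'.1.IsLAlgebraic → (∀ᶠ v : IsDedekindDomain.HeightOneSpectrum (NumberField.RingOfIntegers K) in cofinite,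 SatakeFrobCompatibleAt ι π'.1 t v) → ∃ ρ : Literature.NumberTheory.GaloisRepresentations.FramedGaloisRep K (PadicAlgCl ℓ) n, ρ.toGaloisRep.IsSemisimple ∧ ∀ᶠ v : IsDedekindDomain.HeightOneSpectrum (NumberField.RingOfIntegers K) in cofinite, SatakeFrobCompatibleAt ι π.1 ρ v

/-! ## §2 No-excess edges -/

/-- An irreducible framed Galois representation is semisimple (a simple lattice of subrepresentations is
complemented). [folklore] -/
theorem isSemisimple_of_isIrreducible {F : Type} [Field F] {ℓ n : ℕ} [Fact ℓ.Prime]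
    (r : FramedGaloisRep F (PadicAlgCl ℓ) n) (h : r.toGaloisRep.IsIrreducible) :
    r.toGaloisRep.IsSemisimple := by
  haveI : Representation.IsIrreducible r.toGaloisRep.toRepresentation := h
  change ComplementedLattice _
  infer_instance

/-- A framed Galois representation whose restriction to `Γ_L` is irreducible is irreducible (local copy of
`FramedGaloisRep.isIrreducible_of_restrictField` of `SL2WreathResidualImage.lean`, not imported here). [folklore] -/
theorem isIrreducible_of_restrictField {F : Type} [Field F] {A : Type*} [Field A] [TopologicalSpace A]
    [IsTopologicalRing A] {n : ℕ} (L : Type*) [Field L] [Algebra F L] (ρ : FramedGaloisRep F A n)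
    (h : (ρ.restrictField L).toGaloisRep.IsIrreducible) : ρ.toGaloisRep.IsIrreducible :=
  Literature.RepresentationTheory.Semisimple.Representation.isIrreducible_of_isIrreducible_comp
    ρ.toRepresentation (absGaloisRestrict F L).toMonoidHom h

/-- CPD → CTM (apply CPD to the avatar `t|_{Γ_M}` of `P`; the witnesses `t`, `π'` are not needed). [folklore] -/
theorem converseTwistMatching_of_primeCyclic (h : CyclicLayerPeeling.PrimeCyclicLayerDescent) :
    ConverseTwistMatching := by
  intro K _ _ n hcpt hn π hπ M _ _ _ hGal hcyc hp hM P hP hBC ℓ _ ι t htirr htc π' _ _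
  exact h K n hcpt hn π hπ M hGal hcyc hp hM P hP hBC ℓ ι (t.restrictField M)
    (isSemisimple_of_isIrreducible _ htirr) htc

/-- E → CTM (the conclusion of CTM is E's for `π`). [folklore] -/
theorem converseTwistMatching_of_semisimpleAvatar (hE : RootDecomp1.SemisimpleAvatar) :
    ConverseTwistMatching := by
  intro K _ _ n hcpt hn π hπ M _ _ _ _ _ _ hM P _ _ ℓ _ ι _ _ _ _ _ _
  exact hE K n hcpt hn π hπ ℓ ι

/-- CTM → CTM♮ (drop the guard). [folklore] -/
theorem converseTwistMatchingGuarded_of_converseTwistMatching (h : ConverseTwistMatching) :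
    ConverseTwistMatchingGuarded := by
  intro K _ _ n hcpt hn π hπ M _ _ _ hGal hcyc hp _ hM P hP hBC ℓ _ ι t htirr htc π' hπ' hπ't
  exact h K n hcpt hn π hπ M hGal hcyc hp hM P hP hBC ℓ ι t htirr htc π' hπ' hπ't

/-- CPD♮ → CTM♮ (apply CPD♮, guard and all, to the avatar `t|_{Γ_M}` of `P`). [folklore] -/
theorem converseTwistMatchingGuarded_of_nonSelfTwisted
    (h : RankMinimalPeeling.NonSelfTwistedPrimeCyclicLayerDescent) : ConverseTwistMatchingGuarded := by
  intro K _ _ n hcpt hn π hπ M _ _ _ hGal hcyc hp hguard hM P hP hBC ℓ _ ι t htirr htc π' _ _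
  exact h K n hcpt hn π hπ M hGal hcyc hp hguard hM P hP hBC ℓ ι (t.restrictField M)
    (isSemisimple_of_isIrreducible _ htirr) htc

/-- E → CTM♮. [folklore] -/
theorem converseTwistMatchingGuarded_of_semisimpleAvatar (hE : RootDecomp1.SemisimpleAvatar) :
    ConverseTwistMatchingGuarded :=
  converseTwistMatchingGuarded_of_converseTwistMatching (converseTwistMatching_of_semisimpleAvatar hE)

/-! ## §3 Kernels -/

section FrobStable

variable {K L : Type} [Field K] [NumberField K] [Field L] [NumberField L] [Algebra K L]
  {n : ℕ} {ℓ : ℕ} [Fact ℓ.Prime]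

/-- **A weak base change has `Gal(L/K)`-stable Frobenius polynomials on every compatible Galois
representation** (local copy of `SmithKummerSeedCyclicPrimeDescent.frobStable_of_isWeakBaseChangeLiftAE`, whose
module is not imported here).  Let `L/K` be Galois, `P` on `GL_n(𝔸_L)` a weak base-change lift of `π` on
`GL_n(𝔸_K)` and `ρ' : Γ_L → GL_n(ℚ̄_ℓ)` a.e. Satake–Frobenius compatible with `P`.  Then for every
`σ ∈ Gal(L/K)`, at almost every `w` the Frobenius polynomials of `ρ'` at `w` and at `σ • w` coincide (both are
the Satake polynomial of `Sat(π_v)^f`, `q_w = q_{σ w} = q_v^f`). [cite: ArthurClozelAMS120, Ch. 3 (1.1) and Lemma 1.3] -/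
theorem frobStable_of_isWeakBaseChangeLiftAE [IsGalois K L] {hK : isCompact_glFiniteIntegralLevel n K}
    {hL : isCompact_glFiniteIntegralLevel n L} (ι : PadicAlgCl ℓ ≃+* ℂ)
    (π : AutomorphicRepData (AutomorphyDatum.gl n K hK)) (P : AutomorphicRepData (AutomorphyDatum.gl n L hL))
    (hBC : IsWeakBaseChangeLiftAE π P) (ρ' : FramedGaloisRep L (PadicAlgCl ℓ) n)
    (h : ∀ᶠ w : HeightOneSpectrum (𝓞 L) in cofinite, SatakeFrobCompatibleAt ι P ρ' w)
    (σ : L ≃ₐ[K] L) :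
    ∀ᶠ w : HeightOneSpectrum (𝓞 L) in cofinite,
      ∃ Q : Polynomial (PadicAlgCl ℓ), ρ'.HasFrobCharpolyAt w Q ∧ ρ'.HasFrobCharpolyAt (σ • w) Q := by
  have hgood := (eventually_forall_under_eq (F := K) (h.and hBC)).and
    (AutomorphicRepData.hasSatakeParamAt_cofinite_holds π)
  refine (eventually_under (E := L) hgood).mono fun w hw => ?_
  obtain ⟨hall, α, hα⟩ := hw (w.under (𝓞 K)) rfl
  have hwv : w.asIdeal.under (𝓞 K) = (w.under (𝓞 K)).asIdeal := rfl
  have hσwv : (σ • w).asIdeal.under (𝓞 K) = (w.under (𝓞 K)).asIdeal :=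
    congrArg HeightOneSpectrum.asIdeal
      (HeightOneSpectrum.under_algEquiv_smul (F := K) (E := L) (σ := σ) (w := w))
  have key : ∀ w'' : HeightOneSpectrum (𝓞 L), w''.asIdeal.under (𝓞 K) = (w.under (𝓞 K)).asIdeal →
      ρ'.HasFrobCharpolyAt w'' (arithFrobPolyOfSatake ι
        ((w.under (𝓞 K)).residueCard ^ w''.asIdeal.inertiaDeg (𝓞 K)) 1
          (α.map (· ^ w''.asIdeal.inertiaDeg (𝓞 K)))) := by
    intro w'' hw''
    obtain ⟨⟨β, hβ, -, hc⟩, hbc⟩ := hall w'' hw''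
    obtain rfl : β = α.map (· ^ w''.asIdeal.inertiaDeg (𝓞 K)) :=
      AutomorphicRepData.hasSatakeParamAt_unique_holds P hβ (hbc _ α hw'' hα)
    rwa [residueCard_eq_residueCard_pow_inertiaDeg hw''] at hc
  refine ⟨_, key w hwv, ?_⟩
  have e := key (σ • w) hσwv
  rwa [HeightOneSpectrum.inertiaDeg_algEquiv_smul (F := K) (E := L) (σ := σ) (w := w)] at e

end FrobStable

/-! The unramified-descent helpers `isUnramifiedAt_of_restrictField_of_forall_inertia_le` and
`eventually_isUnramifiedAt_of_restrictField` are the LANDED theorems of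
`Summit.Langlands.Langlands.Theorems.SmithKummerSeedCyclicPrimeAscent` (module
`Theorems/SmithKummerSeedCyclicPrimeAscentGeometricDescent.lean`), imported above (census G41 remedy: no local copies). -/

section Kernel

variable {K : Type} [Field K] [NumberField K] {M : Type} [Field M] [NumberField M] [Algebra K M]
  {n ℓ : ℕ} [Fact ℓ.Prime]

/-- **The converse step** (steps 1–3 of the header, all tree theorems + the root binders `Irr`, `P`, `B_w`):
from a semisimple avatar `r` over the cyclic prime layer `M` of the cuspidal L-algebraic weak base change `P`
of `π`, produce `t : Γ_K → GL_n(ℚ̄_ℓ)` with `t|_{Γ_M} = r` irreducible and a cuspidal L-algebraic `π'` over `K`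
a.e. compatible with `t`. [cite: HarrisTaylorAMS2001, proof of Thm. VII.1.9] [cite: BrinonConrad2009, Prop. 6.3.8] -/
theorem exists_extension_and_automorphicWitness [IsGalois K M] [IsCyclic (M ≃ₐ[K] M)]
    (hIrr : RootDecomp1.CuspidalAvatarIrreducible) (hPM : RootDecomp1.PadicMemberCompatibility)
    (hBw : RootDecomp1.WeakGeometricAutomorphy)
    {hcpt : isCompact_glFiniteIntegralLevel n K} {hM : isCompact_glFiniteIntegralLevel n M} (hn : 0 < n)
    (π : CuspidalAutomorphicRepData n K hcpt) (P : CuspidalAutomorphicRepData n M hM)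
    (hP : P.1.IsLAlgebraic) (hBC : IsWeakBaseChangeLiftAE π.1 P.1) (ι : PadicAlgCl ℓ ≃+* ℂ)
    (r : FramedGaloisRep M (PadicAlgCl ℓ) n) (hr : r.toGaloisRep.IsSemisimple)
    (hrc : ∀ᶠ w : HeightOneSpectrum (𝓞 M) in cofinite, SatakeFrobCompatibleAt ι P.1 r w) :
    ∃ t : FramedGaloisRep K (PadicAlgCl ℓ) n, t.restrictField M = r ∧
      (t.restrictField M).toGaloisRep.IsIrreducible ∧
      (∀ᶠ w : HeightOneSpectrum (𝓞 M) in cofinite, SatakeFrobCompatibleAt ι P.1 (t.restrictField M) w) ∧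
      ∃ π' : CuspidalAutomorphicRepData n K hcpt, π'.1.IsLAlgebraic ∧
        ∀ᶠ v : HeightOneSpectrum (𝓞 K) in cofinite, SatakeFrobCompatibleAt ι π'.1 t v := by
  haveI : FiniteDimensional K M := Module.Finite.of_restrictScalars_finite ℚ K M
  -- step 1: `r` is irreducible (Irr over `M`), unramified a.e., with `Gal(M/K)`-stable Frobenius data
  have hirr : r.toGaloisRep.IsIrreducible := hIrr M n hM hn P hP ℓ ι r hr hrc
  have hunr : ∀ᶠ w : HeightOneSpectrum (𝓞 M) in cofinite, r.IsUnramifiedAt w :=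
    hrc.mono fun w ⟨_, _, hur, _⟩ => hur
  obtain ⟨t, ht⟩ := FramedGaloisRep.exists_restrictField_eq_of_frobStable r hirr hunr
    (frobStable_of_isWeakBaseChangeLiftAE ι π.1 P.1 hBC r hrc)
  have htirrM : (t.restrictField M).toGaloisRep.IsIrreducible := by rw [ht]; exact hirr
  have htc : ∀ᶠ w : HeightOneSpectrum (𝓞 M) in cofinite,
      SatakeFrobCompatibleAt ι P.1 (t.restrictField M) w := by rw [ht]; exact hrc
  have htirr : t.toGaloisRep.IsIrreducible := isIrreducible_of_restrictField M t htirrM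
  -- step 2: `t` is geometric over `K`
  have hdRM : ∀ (w : HeightOneSpectrum (𝓞 M)) (hw : ((ℓ : ℕ) : 𝓞 M) ∈ w.asIdeal),
      (Literature.NumberTheory.PAdicHodge.fontainePstAdicCompletion w ℓ hw).IsDeRhamFramed
        ((t.restrictField M).toLocal w) :=
    fun w hw => (hPM M n hM hn P hP ℓ ι (t.restrictField M) htirrM htc w hw).1
  have hdR : ∀ (v : HeightOneSpectrum (𝓞 K)) (hv : ((ℓ : ℕ) : 𝓞 K) ∈ v.asIdeal),
      (Literature.NumberTheory.PAdicHodge.fontainePstAdicCompletion v ℓ hv).IsDeRhamFramed (t.toLocal v) :=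
    Literature.NumberTheory.PAdicHodge.DeRhamRestrictFieldDescent_holds K M ℓ n t hdRM
  have htunr : ∀ᶠ v : HeightOneSpectrum (𝓞 K) in cofinite, t.IsUnramifiedAt v :=
    Summit.Langlands.Langlands.Theorems.SmithKummerSeedCyclicPrimeAscent.eventually_isUnramifiedAt_of_restrictField t (by rw [ht]; exact hunr)
  -- step 3: `B_w` makes `t` automorphic
  obtain ⟨π', hπ', hπ't⟩ := hBw K n hcpt hn ℓ ι t htirr ⟨htunr, hdR⟩
  exact ⟨t, ht, htirrM, htc, π', hπ', hπ't⟩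

end Kernel

/-- **KERNEL: CPD is in the cone of `Irr ∧ P ∧ B_w` modulo CTM.** [cite: ArthurClozelAMS120, Ch. 3 Thm. 3.1] -/
theorem primeCyclic_of_converse (hIrr : RootDecomp1.CuspidalAvatarIrreducible)
    (hPM : RootDecomp1.PadicMemberCompatibility) (hBw : RootDecomp1.WeakGeometricAutomorphy)
    (hT : ConverseTwistMatching) : CyclicLayerPeeling.PrimeCyclicLayerDescent := by
  intro K _ _ n hcpt hn π hπ M _ _ _ hGal hcyc hp hM P hP hBC ℓ _ ι r hr hrc
  haveI := hGal
  haveI := hcyc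
  obtain ⟨t, -, htirrM, htc, π', hπ', hπ't⟩ :=
    exists_extension_and_automorphicWitness hIrr hPM hBw hn π P hP hBC ι r hr hrc
  exact hT K n hcpt hn π hπ M hGal hcyc hp hM P hP hBC ℓ ι t htirrM htc π' hπ' hπ't

/-- **KERNEL (guarded): CPD♮ is in the cone of `Irr ∧ P ∧ B_w` modulo CTM♮.** [cite: ArthurClozelAMS120, Ch. 3 Thm. 3.1] -/
theorem nonSelfTwisted_of_converseGuarded (hIrr : RootDecomp1.CuspidalAvatarIrreducible)
    (hPM : RootDecomp1.PadicMemberCompatibility) (hBw : RootDecomp1.WeakGeometricAutomorphy)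
    (hT : ConverseTwistMatchingGuarded) : RankMinimalPeeling.NonSelfTwistedPrimeCyclicLayerDescent := by
  intro K _ _ n hcpt hn π hπ M _ _ _ hGal hcyc hp hguard hM P hP hBC ℓ _ ι r hr hrc
  haveI := hGal
  haveI := hcyc
  obtain ⟨t, -, htirrM, htc, π', hπ', hπ't⟩ :=
    exists_extension_and_automorphicWitness hIrr hPM hBw hn π P hP hBC ι r hr hrc
  exact hT K n hcpt hn π hπ M hGal hcyc hp hguard hM P hP hBC ℓ ι t htirrM htc π' hπ' hπ't

/-- CPD♮ from the unguarded CTM (through CPD). [folklore] -/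
theorem nonSelfTwisted_of_converse (hIrr : RootDecomp1.CuspidalAvatarIrreducible)
    (hPM : RootDecomp1.PadicMemberCompatibility) (hBw : RootDecomp1.WeakGeometricAutomorphy)
    (hT : ConverseTwistMatching) : RankMinimalPeeling.NonSelfTwistedPrimeCyclicLayerDescent :=
  RankMinimalPeeling.nonSelfTwisted_of_primeCyclic (primeCyclic_of_converse hIrr hPM hBw hT)

/-- **E-line corollary: E from the root cone, CTM♮ and the E-line's remaining binders** (the binder list of
`RankMinimalPeeling.semisimpleAvatar_of_pieces` with its descent atom CPD♮ REPLACED by `Irr, P, B_w, CTM♮`).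
[cite: ArthurClozelAMS120, Ch. 3 Thm. 3.1, Thm. 4.2, Lemma 6.6] -/
theorem semisimpleAvatar_of_converse (hG : RootDecomp1.DarkPrimitiveAvatars)
    (hAcc : RootDecomp1.AccessibleAvatars) (hIrr : RootDecomp1.CuspidalAvatarIrreducible)
    (hPM : RootDecomp1.PadicMemberCompatibility) (hBw : RootDecomp1.WeakGeometricAutomorphy)
    (hT : ConverseTwistMatchingGuarded) (hP : GaloisHullLift.PerfectHullDescent)
    (hB : CyclicLayerPeeling.CyclicBaseChangeBelow)
    (hAC : ArthurClozel1989_automorphicInduction_of_selfTwist)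
    (hH : Henniart2012_infinityType_of_automorphicInduction)
    (hInf : ∀ (N : ℕ) (E : Type) [Field E] [NumberField E] (hE : isCompact_glFiniteIntegralLevel N E)
      (P : CuspidalAutomorphicRepData N E hE), P.1.exists_hasInfinityType) :
    RootDecomp1.SemisimpleAvatar :=
  RankMinimalPeeling.semisimpleAvatar_of_pieces hG hAcc (nonSelfTwisted_of_converseGuarded hIrr hPM hBw hT)
    hP hB hAC hH hInf

/-- **AvDesc (stmt-Langlands-29149) from the same binders.** [folklore] -/
theorem avatarDescent_of_converse (hG : RootDecomp1.DarkPrimitiveAvatars)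
    (hAcc : RootDecomp1.AccessibleAvatars) (hIrr : RootDecomp1.CuspidalAvatarIrreducible)
    (hPM : RootDecomp1.PadicMemberCompatibility) (hBw : RootDecomp1.WeakGeometricAutomorphy)
    (hT : ConverseTwistMatchingGuarded) (hP : GaloisHullLift.PerfectHullDescent)
    (hB : CyclicLayerPeeling.CyclicBaseChangeBelow)
    (hAC : ArthurClozel1989_automorphicInduction_of_selfTwist)
    (hH : Henniart2012_infinityType_of_automorphicInduction)
    (hInf : ∀ (N : ℕ) (E : Type) [Field E] [NumberField E] (hE : isCompact_glFiniteIntegralLevel N E)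
      (P : CuspidalAutomorphicRepData N E hE), P.1.exists_hasInfinityType) :
    RootDecomp1.AvatarDescent :=
  RankMinimalPeeling.avatarDescent_of_pieces hG hAcc (nonSelfTwisted_of_converseGuarded hIrr hPM hBw hT)
    hP hB hAC hH hInf

end Summit.Langlands.Langlands.Theorems.ConverseDescent

end
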